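import Summits.ResolutionOfSingularities.ResolutionOfSingularities.Theorems.MarkedTransferCampaignW31UscFiniteDegree
import Mathlib.Order.OrderIsoNat
import HarnessLib

/-!
# [OURS · L1 W3.1] `CampaignW31EdgeHilbFiniteRange p` FROM THE DICTIONARY — finitely many edge Hilbert functions along
# `Sing(E)_cl` without any finite-generation input (slot W3.1 «u.s.c. first», seat res-L1-s31-pv-2)

Cell `res-hironaka`, rung L, slot W3.1. The typed OURS statement (iii) `CampaignW31EdgeHilbFiniteRange p`
(`Theorems/MarkedTransferCampaignW31EdgeHilbertLsc.lean`, p464862: «only finitely many functions `a ↦ dim_{κ(ξ)} G(ξ)_a` occur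
as `ξ` ranges over `Sing(E)_cl`»; it replaces the role of the single-exponent form of p.87 l.11–14 «the maximum degree of the
edge generators are bounded», typed `S16Proof.U87_2`) was typed with the INTENDED proof «finite generation of `℘(E)` (FACT-LIST
F-21f / typed `U16_1`) bounds the generator degrees». This file proves it from the DICTIONARY (ii) ALONE (plus the existence of
Def. 4.9 edge data along `Sing(E)_cl`, typed `CampaignW31.EdgeDataExist`), with NO finite-generation input:

* `CampaignW31.finite_image_of_upperSemicontinuousOn` — an upper semicontinuous function ON A SUBSET of a Noetherian space with
  values in a well-ordered linear order takes FINITELY MANY values on that subset (u.s.c. + the descending chain condition on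
  closed subsets forbid an infinite ascending chain of attained values; well-foundedness forbids a descending one; infinite
  Erdős–Szekeres, Mathlib `exists_increasing_or_nonincreasing_subseq`);
* `CampaignW31.finite_image_of_uscOn` — hence an `EdgeInv n`-valued function that is `UscOn S` (the slot file's rendering of
  «u.s.c. on `S_cl`» through the lexicographic keys in `ℕ^{n+2}`) takes finitely many values on `S ∩ Z_cl`;
* `CampaignW31.finite_range_edgeHilbAt_of_dictionary` — at ONE ideal exponent on an ambient datum: the dictionary (ii) at `E`
  and an edge-data selection on `Sing(E)_cl` give (seat pv-1's `uscOn_selInv_of_lsc_of_dictionary`, p475766, with input (i)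
  `CampaignW31EdgeHilbLsc_holds`, p474858) u.s.c. of `ξ ↦ Inv_ξ(E)`, hence finitely many `Inv` values, hence — the Hilbert
  function at `ξ` being `N(q(ξ); ·)`, a function of `Inv_ξ(E)` (`hilb_expo_inv`, p467881) — finitely many Hilbert functions;
* `campaignW31EdgeHilbFiniteRange_of_dictionary` — **`CampaignW31EdgeHilbDictionary p → (∀ …, ∃ n, EdgeDataExist p n E
  edgeDataProvenance) → CampaignW31EdgeHilbFiniteRange p`**.

Consequence for the bookkeeping of the slot: with seat pv-1's p475766 (the slot statement from (ii) alone) the finite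
generation of `℘(E)` (F-21f / `U16_1`) is needed NEITHER for the slot statement NOR for (iii); what both consume is the
dictionary (ii) (seat res-L1-s31-pv-3) — i.e. the structure `G(ξ) = κ[ℓ_1^{q_1}, …, ℓ_r^{q_r}]` of the edge algebra — and the
existence of edge data (typed candidate `S04CharAlgebra.Rem4_10_exists`, discharge lane Q-04-009).

HONEST FRAMING. Every declaration is OURS (kernel theorems about Mathlib/tree objects and about the OURS `Prop`s of the W3.1
statement files); NOTHING here is a statement of H. Hironaka's manuscript [Hironaka2017] and nothing of it is asserted.
AI-produced kernel proof; AI review is weaker than expert review.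

## References (context)
* V. Cossart, U. Jannsen, S. Saito, LNM 2270 (2020), Lemma 2.34 (c) (finitely many values — there from generic constancy; here
  from u.s.c. into a well-order). [CossartJannsenSaito2020]
* H. Hironaka, ms. 2017-03-23, p.87 l.11–14 (the boundedness assertion, GAP-LEDGER R17 / typed `U87_2`). [Hironaka2017]
-/

set_option linter.dupNamespace false -- mandated namespace of this single-conjunct summit

open _root_.AlgebraicGeometry _root_.TopologicalSpace _root_.Topology Set

namespace Summit.ResolutionOfSingularities.ResolutionOfSingularities.Theorems

open Literature.AlgebraicGeometry.Resolution
open Literature.AlgebraicGeometry.Hironaka2017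
open Literature.AlgebraicGeometry.Hironaka2017.S02Preliminaries
open Literature.AlgebraicGeometry.Hironaka2017.S04CharAlgebra
open Literature.AlgebraicGeometry.Hironaka2017.Datum
open Literature.AlgebraicGeometry.Hironaka2017.EdgeHilbert

universe u

namespace CampaignW31

/-! ## Upper semicontinuous functions into a well-order take finitely many values on a Noetherian space -/

section Finite

variable {X : Type*} [TopologicalSpace X] {β : Type*} [LinearOrder β]

/-- **An upper semicontinuous function on a subset `s` of a Noetherian space, with values in a well-ordered linear order, takes
finitely many values on `s`.** No infinite strictly increasing sequence of values is attained on `s` (the closed superlevel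
sets of the restriction to the Noetherian subspace `s` would strictly decrease), no strictly decreasing one exists in a
well-order, and an infinite linearly ordered set contains one or the other (Erdős–Szekeres).
[cite: CossartJannsenSaito2020, Lemma 2.34 (c)] -/
theorem finite_image_of_upperSemicontinuousOn [NoetherianSpace X] [WellFoundedLT β] {f : X → β} {s : Set X}
    (hf : UpperSemicontinuousOn f s) : (f '' s).Finite := by
  have hg : UpperSemicontinuous (s.restrict f) := upperSemicontinuousOn_iff_restrict.mpr hf
  -- (1) no strictly increasing sequence of values attained on `s`
  have noinc : ∀ u : ℕ → s, ¬ StrictMono fun i => f (u i) := by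
    intro u hu
    let F : ℕ → Closeds s := fun i => ⟨(s.restrict f) ⁻¹' Set.Ici (f (u i)), hg.isClosed_preimage _⟩
    have hlt : ∀ i, F (i + 1) < F i := by
      intro i
      refine lt_of_le_of_ne ?_ ?_
      · intro x hx
        exact le_trans (hu (Nat.lt_succ_self i)).le hx
      · intro heq
        have hmem : u i ∈ (F i : Set s) := show f (u i) ≤ s.restrict f (u i) from le_rfl
        rw [← heq] at hmem
        exact absurd (show f (u (i + 1)) ≤ f (u i) from hmem) (not_le.mpr (hu (Nat.lt_succ_self i)))
    obtain ⟨k, hk⟩ := WellFounded.not_rel_apply_succ (r := (· < · : Closeds s → Closeds s → Prop)) F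
    exact hk (hlt k)
  -- (2)+(3) an infinite value set would contain a strictly monotone sequence
  by_contra hinf
  have hinf' : (f '' s).Infinite := hinf
  let e := hinf'.natEmbedding
  obtain ⟨g, hmono | hanti⟩ :=
    exists_increasing_or_nonincreasing_subseq (fun a b : β => a < b) fun i => ((e i : ↥(f '' s)) : β)
  · -- strictly increasing values, attained on `s`
    choose v hv using fun i => ((e (g i) : ↥(f '' s))).2
    refine noinc (fun i => ⟨v i, (hv i).1⟩) fun i j hij => ?_
    change f (v i) < f (v j)
    rw [(hv i).2, (hv j).2]
    exact hmono i j hij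
  · -- pairwise non-increasing and injective: strictly decreasing, impossible in a well-order
    have hdec : ∀ i, ((e (g (i + 1)) : ↥(f '' s)) : β) < (e (g i) : ↥(f '' s)) := by
      intro i
      have hne : ((e (g i) : ↥(f '' s)) : β) ≠ (e (g (i + 1)) : ↥(f '' s)) := by
        intro h
        have h1 : g i = g (i + 1) := e.injective (Subtype.ext h)
        exact absurd (g.injective h1) (Nat.succ_ne_self i).symm
      exact lt_of_le_of_ne (not_lt.mp (hanti i (i + 1) (Nat.lt_succ_self i))) hne.symm
    obtain ⟨k, hk⟩ :=
      WellFounded.not_rel_apply_succ (r := (· < · : β → β → Prop)) fun i => ((e (g i) : ↥(f '' s)) : β)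
    exact hk (hdec k)

end Finite

/-! ## Finitely many `Inv` values from upper semicontinuity -/

/-- **An `EdgeInv n`-valued function upper semicontinuous on `S_cl` (typed `UscOn S f`) of a Noetherian scheme takes finitely
many values on `S ∩ Z_cl`** (the keys `(n, n − r, q_1, …, q_r, 0, …) ∈ ℕ^{n+2}` are lexicographically well ordered and
determine the value). [folklore] -/
theorem finite_image_of_uscOn {Z : Scheme.{u}} [NoetherianSpace Z] {n : ℕ} (S : Set Z) (f : Z → EdgeInv n)
    (h : UscOn S f) : (f '' (S ∩ S02Preliminaries.closedPoints Z)).Finite := by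
  have hk : ((fun ξ => (f ξ).key) '' (S ∩ S02Preliminaries.closedPoints Z)).Finite :=
    finite_image_of_upperSemicontinuousOn h
  rw [← Set.image_image (fun v : EdgeInv n => v.key) f] at hk
  exact Set.Finite.of_finite_image hk (EdgeInv.key_injective.injOn)

/-! ## (iii) at one ideal exponent, from the dictionary (ii) -/

section OneExponent

variable {p : ℕ} [Fact p.Prime] {K : Type u} [Field K] [CharP K p]

/-- For `ξ ∈ S_cl` the function read off a selection is `inv` of the selected edge data. [folklore] -/
theorem selInv_of_mem {Z : Scheme.{u}} {n : ℕ} {E : IdealExponent Z}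
    {IsEdgeData : ∀ ⦃X : Scheme.{u}⦄ ⦃p n : ℕ⦄ (E : IdealExponent X) (ξ : X), EdgeDatumAt p n E ξ → Prop}
    (sel : EdgeDataSelection p n E IsEdgeData) {ξ : Z} (hξ : ξ ∈ E.sing ∩ S02Preliminaries.closedPoints Z) :
    selInv sel ξ = inv (sel.D ξ hξ) := by
  unfold selInv
  rw [dif_pos hξ]

/-- **(iii) at ONE ideal exponent from (ii)**: on the ambient scheme of an ambient datum, the dictionary at `E` (for the
provenance predicate `IsEdgeData`) and an edge-data selection on `Sing(E)_cl` with that provenance imply that only FINITELY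
MANY functions `a ↦ dim_{κ(ξ)} G(ξ)_a` occur along `Sing(E)_cl`: u.s.c. of `ξ ↦ Inv_ξ(E)` (pv-1's finite-degree assembly with
(i) `CampaignW31EdgeHilbLsc` proved) ⟹ finitely many `Inv` values ⟹ finitely many `N(q(ξ); ·)` (`hilb_expo_inv`). NOT a
statement of the manuscript. [folklore] -/
theorem finite_range_edgeHilbAt_of_dictionary (A : AmbientDatum p K) {n : ℕ} {E : IdealExponent A.Z}
    {IsEdgeData : ∀ ⦃X : Scheme.{u}⦄ ⦃p n : ℕ⦄ (E : IdealExponent X) (ξ : X), EdgeDatumAt p n E ξ → Prop}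
    (hdict : ∀ ξ ∈ E.sing ∩ S02Preliminaries.closedPoints A.Z, ∀ D : EdgeDatumAt p n E ξ,
      IsEdgeData E ξ D → ∀ a : ℕ, edgeHilbAt E ξ a = (hilb (EdgeDatum.q D) a : ℕ∞))
    (sel : EdgeDataSelection p n E IsEdgeData) :
    (Set.range fun ξ : ↥(E.sing ∩ S02Preliminaries.closedPoints A.Z) =>
      fun a : ℕ => edgeHilbAt E (ξ : A.Z) a).Finite := by
  haveI := noetherianSpace_ambient A
  have husc : UscOn E.sing (selInv sel) :=
    uscOn_selInv_of_lsc_of_dictionary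
      (fun a => (edgeHilbAt_lowerSemicontinuousOn_closedPoints A E a).mono Set.inter_subset_right) hdict sel
  have hfin := finite_image_of_uscOn E.sing (selInv sel) husc
  refine (hfin.image fun v : EdgeInv n => fun a : ℕ => (hilb v.expo a : ℕ∞)).subset ?_
  rintro _ ⟨⟨ξ, hξ⟩, rfl⟩
  refine ⟨selInv sel ξ, ⟨ξ, hξ, rfl⟩, ?_⟩
  funext a
  change (hilb (selInv sel ξ).expo a : ℕ∞) = edgeHilbAt E ξ a
  rw [selInv_of_mem sel hξ, hilb_expo_inv, hdict ξ hξ (sel.D ξ hξ) (sel.isEdgeData ξ hξ) a]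

/-- **Bounded edge exponents from (ii)** (the single-exponent form of p.87 l.11–14 «the maximum degree of the edge generators
are bounded», typed `S16Proof.U87_2`, obtained WITHOUT finite generation): under the same hypotheses there is `Q` with
`q_j(D) ≤ Q` for every closed `ξ ∈ Sing(E)` and every edge data `D` of `℘(E)` at `ξ` with the provenance `IsEdgeData` — finitely
many `Inv` values occur, `Inv` is well defined at each point from the dictionary (p467881 `invWellDefinedAt_of_dictionary`), and
each value lists its exponents. NOT a statement of the manuscript. [folklore] -/
theorem exists_bound_q_of_dictionary (A : AmbientDatum p K) {n : ℕ} {E : IdealExponent A.Z}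
    {IsEdgeData : ∀ ⦃X : Scheme.{u}⦄ ⦃p n : ℕ⦄ (E : IdealExponent X) (ξ : X), EdgeDatumAt p n E ξ → Prop}
    (hdict : ∀ ξ ∈ E.sing ∩ S02Preliminaries.closedPoints A.Z, ∀ D : EdgeDatumAt p n E ξ,
      IsEdgeData E ξ D → ∀ a : ℕ, edgeHilbAt E ξ a = (hilb (EdgeDatum.q D) a : ℕ∞))
    (sel : EdgeDataSelection p n E IsEdgeData) :
    ∃ Q : ℕ, ∀ ξ (hξ : ξ ∈ E.sing ∩ S02Preliminaries.closedPoints A.Z) (D : EdgeDatumAt p n E ξ),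
      IsEdgeData E ξ D → ∀ j, EdgeDatum.q D j ≤ Q := by
  haveI := noetherianSpace_ambient A
  have husc : UscOn E.sing (selInv sel) :=
    uscOn_selInv_of_lsc_of_dictionary
      (fun a => (edgeHilbAt_lowerSemicontinuousOn_closedPoints A E a).mono Set.inter_subset_right) hdict sel
  have hfin := finite_image_of_uscOn E.sing (selInv sel) husc
  -- a bound for the exponents listed in the finitely many values
  obtain ⟨Q, hQ⟩ : ∃ Q : ℕ, ∀ v ∈ selInv sel '' (E.sing ∩ S02Preliminaries.closedPoints A.Z), ∀ x ∈ v.q, x ≤ Q := by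
    refine ⟨hfin.toFinset.sup fun v => (v.q.toFinset.sup id), fun v hv x hx => ?_⟩
    have h1 : x ≤ v.q.toFinset.sup id := Finset.le_sup (f := id) (List.mem_toFinset.mpr hx)
    exact h1.trans (Finset.le_sup (f := fun v : EdgeInv n => v.q.toFinset.sup id) (hfin.mem_toFinset.mpr hv))
  refine ⟨Q, fun ξ hξ D hD j => ?_⟩
  -- `inv D = inv (sel.D ξ hξ)` (well-definedness from the dictionary: equal Hilbert functions)
  have hinv : inv D = inv (sel.D ξ hξ) := by
    refine inv_eq_of_hilb_eq (sel.D ξ hξ) D fun a => ?_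
    have h1 := hdict ξ hξ (sel.D ξ hξ) (sel.isEdgeData ξ hξ) a
    have h2 := hdict ξ hξ D hD a
    rw [h1] at h2
    exact_mod_cast h2
  have hmem : EdgeDatum.q D j ∈ (inv D).q := by
    change EdgeDatum.q D j ∈ List.ofFn (EdgeDatum.q D)
    exact List.mem_ofFn.mpr ⟨j, rfl⟩
  rw [hinv, ← selInv_of_mem sel hξ] at hmem
  exact hQ _ ⟨ξ, hξ, rfl⟩ _ hmem

end OneExponent

end CampaignW31

open CampaignW31

/-- **[OURS · L1 W3.1] `CampaignW31EdgeHilbFiniteRange p` FROM THE DICTIONARY**: if (ii) `CampaignW31EdgeHilbDictionary p` holds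
and, for every perfect `K` of characteristic `p`, ambient datum `A` and standard `E`, Def. 4.9 edge data (row 005 part b's
`IsEdgeData`, packaged as `CampaignW31.edgeDataProvenance`) exist at every closed point of `Sing(E)` for some `n` (typed OURS
`CampaignW31.EdgeDataExist`; in print Rem. 4.10 p.21 l.4–7, typed candidate `S04CharAlgebra.Rem4_10_exists`), then (iii)
`CampaignW31EdgeHilbFiniteRange p` holds — with NO finite-generation input (no `U16_1`, no FACT-LIST F-21f / F-20d). Input (i)
is the kernel theorem `CampaignW31EdgeHilbLsc_holds`. NOT a statement of the manuscript. [folklore] -/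
theorem campaignW31EdgeHilbFiniteRange_of_dictionary (p : ℕ) [Fact p.Prime]
    (hdict : CampaignW31EdgeHilbDictionary.{u} p)
    (hex : ∀ (K : Type u) [Field K] [CharP K p] [PerfectField K] (A : AmbientDatum p K) (E : IdealExponent A.Z),
      E.IsStandard → ∃ n : ℕ, EdgeDataExist p n E edgeDataProvenance) :
    CampaignW31EdgeHilbFiniteRange.{u} p := by
  intro K _ _ _ A E hE
  obtain ⟨n, hn⟩ := hex K A E hE
  let sel : EdgeDataSelection p n E edgeDataProvenance :=
    ⟨fun ξ h => (hn ξ h).choose, fun ξ h => (hn ξ h).choose_spec⟩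
  exact finite_range_edgeHilbAt_of_dictionary A (hdict K A n E hE) sel

end Summit.ResolutionOfSingularities.ResolutionOfSingularities.Theorems
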